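import Literature.AnabelianGeometry.EtaleTheta.Discharge.Sec5Thm56OfStrvAndConnectedAllLeavesGalois
import Literature.AnabelianGeometry.EtaleTheta.Discharge.Sec5Thm56Capstone
import HarnessLib

/-!
# [EtTh] Prop. 5.5 ⊕ Thm. 5.6 (i) K4 CAPSTONE at `ofBiKummerData` (constructed `s^trv_N`) and at the genuine data over `B^temp(Π^tp_X)⁰`
# ON THE v2 SUBQUOTIENT RECORD `ThetaSubquotientProjGalois` — PROOF-ONLY, proofs verbatim

S. Mochizuki, *The étale theta function and its Frobenioid-theoretic manifestations*, Publ. RIMS **45** (2009)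
[cite: MochizukiEtTh2009, Thm 5.6 p.328–329 (PDF pp.102–103); Prop 5.5 p.327–328 (PDF pp.101–102); Cor 2.18 (i) p.286 (PDF p.60); §5 p.327 (PDF p.101) «these subquotients determine subquotients `Aut_D(D) ↠ Aut^Θ_D(D)`»].
abc-iut cell, layer L2, seat abc-iut-w6-d020 (gen 7), row «(w4-S) V1→V2 PORT — deep EndKnit*/AllLeavesV3*/KummerComparisonInputsLevel*
heads» (abc-iut-L2-lead gen 7 R957; VNEXT-CENSUS-L2 §G5 add. 11 standing row «(w4)»), layer S3d = the K4 CAPSTONE head `Sec5Thm56Capstone` (abc-iut-w5-d013).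

WHY.  abc-iut-w5-d013's capstones `exists_rigidityFamily_unique_preserved_ofBiKummerData_capstone` (NO σ-side binder, θ produced, `hKR` from the pin, `hP24`/`hγL` from
Cor. 2.18 (i)) and `…_ofConnectedTemperoidData_capstone` (the same at the genuine connected data) bind
abc-iut-L2-t4's v1 record `(P : ThetaSubquotientProj 𝔉)` asks `proj_surjective` at EVERY base object and is EMPTY at the cell's root model for
`l` odd (abc-iut-L2-t9 p456572, kernel certificate p476337), so there each of these theorems quantifies over an empty type; abc-iut-w6-d079's v2
record `ThetaSubquotientProjGalois 𝔉 Gal` (p481123; surjectivity only at the objects singled out by `Gal`, as print uses it — Prop. 5.1 / Lemma 5.9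
run over connected GALOIS coverings) is INHABITED at every `ofSetting` carrier (p481568) and at every level stub of the junction data (p486065
`RigidData.nonempty_thetaSubquotientProjGalois_of_stub_eq_levelStub`); the v2 clauses `ThetaSubquotientProjGalois.IsKummerDetermined` /
`.CyclotomicRigidity` (p481123 / p484491) and the predicate twins `Thm56Sub.*Gal` (p484491) are the SAME formulas (they read `P` only through
`pre` / `proj` at `Base(B_N)`).

THIS FILE re-keys the listed theorems on the v2 record — binder `{Gal} (P : ThetaSubquotientProjGalois 𝔉 Gal)`, statements otherwise and
proofs VERBATIM (none of the source arguments uses `proj_surjective`), names = the originals with suffix `_galois`: 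
`exists_rigidityFamily_unique_preserved_ofBiKummerData_capstone_galois`, `exists_rigidityFamily_unique_preserved_ofConnectedTemperoidData_capstone_galois` —
consuming this seat's S2b twins `…_of_pin_strv_sectionPair_galois` / `…_ofConnectedTemperoidData_allLeaves_galois` BY NAME.
0 `def`s; no v1 file is edited or restated (the `P`-free producers of the sources are consumed BY NAME); the v1 heads are the `P.toGalois Gal`
instances of these twins (abc-iut-w6-d079's `Iff.rfl` bridges `isKummerDetermined_toGalois_iff`, `cyclotomicRigidity_toGalois_iff`, `…Gal_toGalois_iff`).

HONEST FRAMING: a typing repair of the cell's OWN record (weaker quantifier on `P`, as print uses it); kernel-checked implications between typed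
statements over abc-iut-L2-t4's assembled §5 data; every named leaf / binder of the v1 heads stays NAMED exactly as there; nothing of [EtTh]
(a refereed paper) is asserted; the existence of the data for an actual curve is not claimed; typed ≠ discharged; nothing here bears on [IUTchIII]
Cor. 3.12 — no side taken; nothing here asserts abc proved or refuted.
-/

noncomputable section

namespace Literature.AnabelianGeometry.EtaleTheta

open CategoryTheory Opposite FrobenioidCyclotomicRigidity Literature.AlgebraicGeometry.Frobenioids
  Literature.AnabelianGeometry.SemiGraphs Literature.AnabelianGeometry.SemiGraphs.GaloisObjects

universe u₀ v₀ u v w v₁ u₁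

namespace ThetaFrobenioid

/-! ### Capstone at `ofBiKummerData`, v2 record -/

section Abstract

variable {K : Type u₀} [Field K]
  {X : SemiGraphs.TemperedArithmeticGroup.{u₀} K} {D₀ : Type u₀} [Category.{v₀} D₀]
  {V : FrdIMonoidStub.{w}} {T₀ : RealifiedDivisorMonoids (D₀ := D₀) V} {D : Type u} [Category.{v} D]
  {VD : FrdICatStub.{u, v, w} D} {S : BiKummerSetting X T₀ D VD}
  {pullFrac : ∀ {A A' : S.C} (_ : A' ⟶ A), S.biratUnits A → S.biratUnits A'}
  {lv N : ℕ+} {l' : ℕ} {RD : RigidData.{max v w} N l'} {θ : S.biratUnits S.Aodot} {Bl : S.C}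
  {Pl : S.FractionPair θ Bl} {Rl : S.NthRoot θ Pl lv pullFrac}
  (h : ModelFrobenioid.Hypotheses S.tf.divisorMonoid S.tf.ratFnFunctor)
  (toB : ∀ A : S.C, S.biratUnits A →* S.tf.biratUnitsModel A) (Q : FrobenioidTheta.ThetaSubquotientStub.{w} D)
  (odd_l : Odd (lv : ℕ)) (R : S.NthRoot Rl.root Rl.pair N pullFrac) (ιX : RD.PiX ≃ₜ* X.Pi)
  (hopen : IsOpen ((S.galoisSurj R.AN.base R.αData.isGalois).ker : Set X.Pi))
  (K' : Type w) [Field K'] (constEmb : K'ˣ →* S.tf.biratUnitsModel R.BN)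
  (constEmb_injective : Function.Injective constEmb)
  (hinvc : ∀ g : Aut R.AN.base, pull S.tf.divisorMonoid g.hom (ModelFrobenioid.div R.pair.num) = ModelFrobenioid.div R.pair.num)
  (hinvp : ∀ y : RD.PiX, y ∈ RD.PiYdd →
    pull S.tf.divisorMonoid (S.galoisSurj R.AN.base R.αData.isGalois (ιX y)).hom (ModelFrobenioid.div R.pair.den) =
      ModelFrobenioid.div R.pair.den)
  {Gal : D → Prop}

/-- (v2 record `ThetaSubquotientProjGalois`; the v1 theorem `exists_rigidityFamily_unique_preserved_ofBiKummerData_capstone` VERBATIM — binder type + twin names only.) **K4 CAPSTONE at the abstract §5 data**: [EtTh] Prop. 5.5 ⊕ Thm. 5.6 (i) for `ofBiKummerData` at the CONSTRUCTED `s^trv_N`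
with NO σ-side binder, θ PRODUCED, `hKR` from the pin, and `hP24`/`hγL` from Cor. 2.18 (i).
[cite: MochizukiEtTh2009, Thm 5.6 p.328 (PDF p.102)] -/
theorem exists_rigidityFamily_unique_preserved_ofBiKummerData_capstone_galois
    -- Prop 5.5 side (η / ν pin, reachability, stub laws)
    (hB : (ofBiKummerData h toB Q odd_l R ιX hopen (strvOfBiKummerData h R) K' constEmb constEmb_injective (hdivc_of_pull_invariant h.isDivisorial R (strvOfBiKummerData h R) (baseMap_strvOfBiKummerData h R) hinvc) (hdivp_of_pull_invariant h.isDivisorial R ιX (strvOfBiKummerData h R) (baseMap_strvOfBiKummerData h R) hinvp)).IsThetaSaturated (ofBiKummerData h toB Q odd_l R ιX hopen (strvOfBiKummerData h R) K' constEmb constEmb_injective (hdivc_of_pull_invariant h.isDivisorial R (strvOfBiKummerData h R) (baseMap_strvOfBiKummerData h R) hinvc) (hdivp_of_pull_invariant h.isDivisorial R ιX (strvOfBiKummerData h R) (baseMap_strvOfBiKummerData h R) hinvp)).BN) (P : ThetaSubquotientProjGalois (ofBiKummerData h toB Q odd_l R ιX hopen (strvOfBiKummerData h R) K' constEmb constEmb_injective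 (hdivc_of_pull_invariant h.isDivisorial R (strvOfBiKummerData h R) (baseMap_strvOfBiKummerData h R) hinvc) (hdivp_of_pull_invariant h.isDivisorial R ιX (strvOfBiKummerData h R) (baseMap_strvOfBiKummerData h R) hinvp)) Gal)
    {η₀ : RD.PiYdd → RD.mu} (hη₀ : η₀ ∈ RD.thetaCocycles)
    (hdies : ∀ k : RD.PiYdd, rhoOfBiKummerData R ιX k = 1 → η₀ k = 1)
    (e : RD.mu → (ofBiKummerData h toB Q odd_l R ιX hopen (strvOfBiKummerData h R) K' constEmb constEmb_injective (hdivc_of_pull_invariant h.isDivisorial R (strvOfBiKummerData h R) (baseMap_strvOfBiKummerData h R) hinvc) (hdivp_of_pull_invariant h.isDivisorial R ιX (strvOfBiKummerData h R) (baseMap_strvOfBiKummerData h R) hinvp)).lDeltaModN (ofBiKummerData h toB Q odd_l R ιX hopen (strvOfBiKummerData h R) K' constEmb constEmb_injective (hdivc_of_pull_invariant h.isDivisorial R (strvOfBiKummerData h R) (baseMap_strvOfBiKummerData h R) hinvc) (hdivp_of_pull_invariant h.isDivisorial R ιX (strvOfBiKummerData h R) (baseMap_strvOfBiKummerData h R)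 hinvp)).BN) (he : Function.Surjective e)
    (hpre : ∀ k : RD.PiYdd, (k : RD.PiX) ∈ RD.lDeltaTheta → rhoOfBiKummerData R ιX k ∈ P.pre _)
    (hP : ∀ (k : RD.PiYdd) (hk : (k : RD.PiX) ∈ RD.lDeltaTheta) (hm : rhoOfBiKummerData R ιX k ∈ P.pre _),
      (QuotientGroup.mk (P.proj _ ⟨rhoOfBiKummerData R ιX k, hm⟩) : (ofBiKummerData h toB Q odd_l R ιX hopen (strvOfBiKummerData h R) K' constEmb constEmb_injective (hdivc_of_pull_invariant h.isDivisorial R (strvOfBiKummerData h R) (baseMap_strvOfBiKummerData h R) hinvc) (hdivp_of_pull_invariant h.isDivisorial R ιX (strvOfBiKummerData h R) (baseMap_strvOfBiKummerData h R) hinvp)).lDeltaModN (ofBiKummerData h toB Q odd_l R ιX hopen (strvOfBiKummerData h R) K' constEmb constEmb_injective (hdivc_of_pull_invariant h.isDivisorial R (strvOfBiKummerData h R) (baseMap_strvOfBiKummerData h R) hinvc) (hdivp_of_pull_invariant h.isDivisorial R ιX (strvOfBiKummerData h R) (baseMap_strvOfBiKummerData h R) hinvp)).BN) = e (RD.thetaMod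 ⟨k, hk⟩))
    (hcov' : ∀ g ∈ P.pre ((ofBiKummerData h toB Q odd_l R ιX hopen (strvOfBiKummerData h R) K' constEmb constEmb_injective (hdivc_of_pull_invariant h.isDivisorial R (strvOfBiKummerData h R) (baseMap_strvOfBiKummerData h R) hinvc) (hdivp_of_pull_invariant h.isDivisorial R ιX (strvOfBiKummerData h R) (baseMap_strvOfBiKummerData h R) hinvp)).base.obj (ofBiKummerData h toB Q odd_l R ιX hopen (strvOfBiKummerData h R) K' constEmb constEmb_injective (hdivc_of_pull_invariant h.isDivisorial R (strvOfBiKummerData h R) (baseMap_strvOfBiKummerData h R) hinvc) (hdivp_of_pull_invariant h.isDivisorial R ιX (strvOfBiKummerData h R) (baseMap_strvOfBiKummerData h R) hinvp)).BN), ∃ k : RD.PiYdd, (k : RD.PiX) ∈ RD.lDeltaTheta ∧ rhoOfBiKummerData R ιX k = g)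
    (ν : (ofBiKummerData h toB Q odd_l R ιX hopen (strvOfBiKummerData h R) K' constEmb constEmb_injective (hdivc_of_pull_invariant h.isDivisorial R (strvOfBiKummerData h R) (baseMap_strvOfBiKummerData h R) hinvc) (hdivp_of_pull_invariant h.isDivisorial R ιX (strvOfBiKummerData h R) (baseMap_strvOfBiKummerData h R) hinvp)).lDeltaModN (ofBiKummerData h toB Q odd_l R ιX hopen (strvOfBiKummerData h R) K' constEmb constEmb_injective (hdivc_of_pull_invariant h.isDivisorial R (strvOfBiKummerData h R) (baseMap_strvOfBiKummerData h R) hinvc) (hdivp_of_pull_invariant h.isDivisorial R ιX (strvOfBiKummerData h R) (baseMap_strvOfBiKummerData h R) hinvp)).BN ≃* (ofBiKummerData h toB Q odd_l R ιX hopen (strvOfBiKummerData h R) K' constEmb constEmb_injective (hdivc_of_pull_invariant h.isDivisorial R (strvOfBiKummerData h R) (baseMap_strvOfBiKummerData h R) hinvc) (hdivp_of_pull_invariant h.isDivisorial R ιX (strvOfBiKummerData h R) (baseMap_strvOfBiKummerData h R) hinvp)).muTorsion (ofBiKummerData h toB Q odd_l R ιX hopen (strvOfBiKummerData h R) K' constEmb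 constEmb_injective (hdivc_of_pull_invariant h.isDivisorial R (strvOfBiKummerData h R) (baseMap_strvOfBiKummerData h R) hinvc) (hdivp_of_pull_invariant h.isDivisorial R ιX (strvOfBiKummerData h R) (baseMap_strvOfBiKummerData h R) hinvp)).BN (ofBiKummerData h toB Q odd_l R ιX hopen (strvOfBiKummerData h R) K' constEmb constEmb_injective (hdivc_of_pull_invariant h.isDivisorial R (strvOfBiKummerData h R) (baseMap_strvOfBiKummerData h R) hinvc) (hdivp_of_pull_invariant h.isDivisorial R ιX (strvOfBiKummerData h R) (baseMap_strvOfBiKummerData h R) hinvp)).N)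
    (hKν : ∀ η : (ofBiKummerData h toB Q odd_l R ιX hopen (strvOfBiKummerData h R) K' constEmb constEmb_injective (hdivc_of_pull_invariant h.isDivisorial R (strvOfBiKummerData h R) (baseMap_strvOfBiKummerData h R) hinvc) (hdivp_of_pull_invariant h.isDivisorial R ιX (strvOfBiKummerData h R) (baseMap_strvOfBiKummerData h R) hinvp)).HB → (ofBiKummerData h toB Q odd_l R ιX hopen (strvOfBiKummerData h R) K' constEmb constEmb_injective (hdivc_of_pull_invariant h.isDivisorial R (strvOfBiKummerData h R) (baseMap_strvOfBiKummerData h R) hinvc) (hdivp_of_pull_invariant h.isDivisorial R ιX (strvOfBiKummerData h R) (baseMap_strvOfBiKummerData h R) hinvp)).lDeltaModN (ofBiKummerData h toB Q odd_l R ιX hopen (strvOfBiKummerData h R) K' constEmb constEmb_injective (hdivc_of_pull_invariant h.isDivisorial R (strvOfBiKummerData h R) (baseMap_strvOfBiKummerData h R) hinvc) (hdivp_of_pull_invariant h.isDivisorial R ιX (strvOfBiKummerData h R) (baseMap_strvOfBiKummerData h R) hinvp)).BN,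
      (∀ k : RD.PiYdd, η ⟨rhoOfBiKummerData R ιX k, Subgroup.mem_map_of_mem _ k.2⟩ = e (η₀ k)) →
        FrobenioidThetaBiKummer.ThetaPairKummerClass (ofBiKummerData h toB Q odd_l R ιX hopen (strvOfBiKummerData h R) K' constEmb constEmb_injective (hdivc_of_pull_invariant h.isDivisorial R (strvOfBiKummerData h R) (baseMap_strvOfBiKummerData h R) hinvc) (hdivp_of_pull_invariant h.isDivisorial R ιX (strvOfBiKummerData h R) (baseMap_strvOfBiKummerData h R) hinvp)) η ν)
    (hgeom : P.pre R.BN.base ≤ RD.aug.ker.map (rhoOfBiKummerData R ιX))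
    -- T56-L09b: Prop 3.4 (ii) constants + the origin clause «cnst kills Ker aug» (G-w5d020-2)
    {Dcnst : Type u₁} [Category.{v₁} Dcnst] {cnst : D₀ ⥤ Dcnst} (hP34 : RealifiedDivisorMonoids.Prop34Cnst T₀ cnst)
    (hΔcnst : ∀ δ ∈ RD.aug.ker,
      cnst.map (S.tf.base.map (rhoOfBiKummerData R ιX δ).hom) = 𝟙 (cnst.obj (S.tf.base.obj R.BN.base)))
    (hreach : LinearlyReachableFromBN (ofBiKummerData h toB Q odd_l R ιX hopen (strvOfBiKummerData h R) K' constEmb constEmb_injective (hdivc_of_pull_invariant h.isDivisorial R (strvOfBiKummerData h R) (baseMap_strvOfBiKummerData h R) hinvc) (hdivp_of_pull_invariant h.isDivisorial R ιX (strvOfBiKummerData h R) (baseMap_strvOfBiKummerData h R) hinvp)))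
    (hLc : Thm56Sub.LDeltaMapComp (ofBiKummerData h toB Q odd_l R ιX hopen (strvOfBiKummerData h R) K' constEmb constEmb_injective (hdivc_of_pull_invariant h.isDivisorial R (strvOfBiKummerData h R) (baseMap_strvOfBiKummerData h R) hinvc) (hdivp_of_pull_invariant h.isDivisorial R ιX (strvOfBiKummerData h R) (baseMap_strvOfBiKummerData h R) hinvp))) (hLi : Thm56Sub.LDeltaMapId (ofBiKummerData h toB Q odd_l R ιX hopen (strvOfBiKummerData h R) K' constEmb constEmb_injective (hdivc_of_pull_invariant h.isDivisorial R (strvOfBiKummerData h R) (baseMap_strvOfBiKummerData h R) hinvc) (hdivp_of_pull_invariant h.isDivisorial R ιX (strvOfBiKummerData h R) (baseMap_strvOfBiKummerData h R) hinvp)))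
    -- P55-L06 leaves: (G) as the base law, hproj named, hcup as the pull-root law of abc-iut-L6-t23
    (hGalT : ∀ ⦃A : D⦄, S.IsGaloisObj A → ∀ ⦃T : D⦄ (b b' : A ⟶ T), ∃ g : Aut A, b' = g.hom ≫ b)
    (hproj : ∀ (g g' : Aut ((ofBiKummerData h toB Q odd_l R ιX hopen (strvOfBiKummerData h R) K' constEmb constEmb_injective (hdivc_of_pull_invariant h.isDivisorial R (strvOfBiKummerData h R) (baseMap_strvOfBiKummerData h R) hinvc) (hdivp_of_pull_invariant h.isDivisorial R ιX (strvOfBiKummerData h R) (baseMap_strvOfBiKummerData h R) hinvp)).base.obj (ofBiKummerData h toB Q odd_l R ιX hopen (strvOfBiKummerData h R) K' constEmb constEmb_injective (hdivc_of_pull_invariant h.isDivisorial R (strvOfBiKummerData h R) (baseMap_strvOfBiKummerData h R) hinvc) (hdivp_of_pull_invariant h.isDivisorial R ιX (strvOfBiKummerData h R) (baseMap_strvOfBiKummerData h R) hinvp)).BN)) (hh : g' ∈ P.pre _), ∃ hgh : g * g' * g⁻¹ ∈ P.pre _,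
      (ofBiKummerData h toB Q odd_l R ιX hopen (strvOfBiKummerData h R) K' constEmb constEmb_injective (hdivc_of_pull_invariant h.isDivisorial R (strvOfBiKummerData h R) (baseMap_strvOfBiKummerData h R) hinvc) (hdivp_of_pull_invariant h.isDivisorial R ιX (strvOfBiKummerData h R) (baseMap_strvOfBiKummerData h R) hinvp)).lDeltaMap g.hom (P.proj _ ⟨g', hh⟩) = P.proj _ ⟨g * g' * g⁻¹, hgh⟩)
    -- hKR (G-L6t23-3) by abc-iut-w4-d099's PIN route (p-file Sec5ThetaSectionCompatOfKummerClass): «Prop 5.2 (iii) enters ONCE» —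
    -- the (η₀, ν) pin above + Facts + the cyclotome dictionary m with m ∘ ν ∘ e = id + cyclotomic-character compatibility (F-1306)
    (H : (ofBiKummerData h toB Q odd_l R ιX hopen (strvOfBiKummerData h R) K' constEmb constEmb_injective (hdivc_of_pull_invariant h.isDivisorial R (strvOfBiKummerData h R) (baseMap_strvOfBiKummerData h R) hinvc) (hdivp_of_pull_invariant h.isDivisorial R ιX (strvOfBiKummerData h R) (baseMap_strvOfBiKummerData h R) hinvp)).Facts)
    (m : (ofBiKummerData h toB Q odd_l R ιX hopen (strvOfBiKummerData h R) K' constEmb constEmb_injective (hdivc_of_pull_invariant h.isDivisorial R (strvOfBiKummerData h R) (baseMap_strvOfBiKummerData h R) hinvc) (hdivp_of_pull_invariant h.isDivisorial R ιX (strvOfBiKummerData h R) (baseMap_strvOfBiKummerData h R) hinvp)).muTorsion (ofBiKummerData h toB Q odd_l R ιX hopen (strvOfBiKummerData h R) K' constEmb constEmb_injective (hdivc_of_pull_invariant h.isDivisorial R (strvOfBiKummerData h R) (baseMap_strvOfBiKummerData h R) hinvc) (hdivp_of_pull_invariant h.isDivisorial R ιX (strvOfBiKummerData h R) (baseMap_strvOfBiKummerData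 h R) hinvp)).BN (ofBiKummerData h toB Q odd_l R ιX hopen (strvOfBiKummerData h R) K' constEmb constEmb_injective (hdivc_of_pull_invariant h.isDivisorial R (strvOfBiKummerData h R) (baseMap_strvOfBiKummerData h R) hinvc) (hdivp_of_pull_invariant h.isDivisorial R ιX (strvOfBiKummerData h R) (baseMap_strvOfBiKummerData h R) hinvp)).N ≃* RD.mu)
    (hme : ∀ x : RD.mu, m (ν (e x)) = x)
    (hχX : (ofBiKummerData h toB Q odd_l R ιX hopen (strvOfBiKummerData h R) K' constEmb constEmb_injective (hdivc_of_pull_invariant h.isDivisorial R (strvOfBiKummerData h R) (baseMap_strvOfBiKummerData h R) hinvc) (hdivp_of_pull_invariant h.isDivisorial R ιX (strvOfBiKummerData h R) (baseMap_strvOfBiKummerData h R) hinvp)).CyclotomicCharacterCompatX RD.toThetaEnvData (MulEquiv.refl _) m)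
    (hcovHB : ∀ k : (ofBiKummerData h toB Q odd_l R ιX hopen (strvOfBiKummerData h R) K' constEmb constEmb_injective (hdivc_of_pull_invariant h.isDivisorial R (strvOfBiKummerData h R) (baseMap_strvOfBiKummerData h R) hinvc) (hdivp_of_pull_invariant h.isDivisorial R ιX (strvOfBiKummerData h R) (baseMap_strvOfBiKummerData h R) hinvp)).HB, (k : Aut ((ofBiKummerData h toB Q odd_l R ιX hopen (strvOfBiKummerData h R) K' constEmb constEmb_injective (hdivc_of_pull_invariant h.isDivisorial R (strvOfBiKummerData h R) (baseMap_strvOfBiKummerData h R) hinvc) (hdivp_of_pull_invariant h.isDivisorial R ιX (strvOfBiKummerData h R) (baseMap_strvOfBiKummerData h R) hinvp)).base.obj (ofBiKummerData h toB Q odd_l R ιX hopen (strvOfBiKummerData h R) K' constEmb constEmb_injective (hdivc_of_pull_invariant h.isDivisorial R (strvOfBiKummerData h R) (baseMap_strvOfBiKummerData h R) hinvc) (hdivp_of_pull_invariant h.isDivisorial R ιX (strvOfBiKummerData h R) (baseMap_strvOfBiKummerData h R) hinvp)).BN)) ∈ P.pre _ →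
      ∃ (y : RD.PiX) (_ : y ∈ RD.PiYdd), (ofBiKummerData h toB Q odd_l R ιX hopen (strvOfBiKummerData h R) K' constEmb constEmb_injective (hdivc_of_pull_invariant h.isDivisorial R (strvOfBiKummerData h R) (baseMap_strvOfBiKummerData h R) hinvc) (hdivp_of_pull_invariant h.isDivisorial R ιX (strvOfBiKummerData h R) (baseMap_strvOfBiKummerData h R) hinvp)).ρ y = k ∧ y ∈ RD.lDeltaTheta)
    -- t4's inputs discharging hdiff ([FrdI] Prop 5.6 section law, Π^tp_Ÿ ⊆ H_⊙, Thm 5.2 (ii) dictionary)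
    (hH : ∀ y : RD.PiX, y ∈ RD.PiYdd → ιX y ∈ S.Hodot)
    (hfrac : ∀ {A B : S.C} (s' s'' : A ⟶ B) (h' : S.IsPreStep s') (h'' : S.IsPreStep s'')
      (hb : PreFrobenioid.BaseEquivalent S.F s' s''),
      (toB A (S.fracOf s' s'' h' h'' hb) : S.tf.ratFnFunctor.obj (op A.base)) *
        ModelFrobenioid.unit s'' = ModelFrobenioid.unit s')
    (haut : ∀ {A : S.C} (e : Aut A) (x : S.biratUnits A),
      (toB A (S.biratAut A e x) : S.tf.ratFnFunctor.obj (op A.base)) =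
        pull S.tf.ratFnFunctor (ModelFrobenioid.baseMap e.inv) (toB A x : S.tf.ratFnFunctor.obj (op A.base)))
    -- Thm 5.6 side: Ψ, its base shadow, Δ-transport and μ-pull data (abc-iut-L2-d4)
    (Ψ : S.C ≌ S.C) (Ψbs : D ⥤ D) [Ψbs.Faithful] (eΨ : Ψ.functor ⋙ (ofBiKummerData h toB Q odd_l R ιX hopen (strvOfBiKummerData h R) K' constEmb constEmb_injective (hdivc_of_pull_invariant h.isDivisorial R (strvOfBiKummerData h R) (baseMap_strvOfBiKummerData h R) hinvc) (hdivp_of_pull_invariant h.isDivisorial R ιX (strvOfBiKummerData h R) (baseMap_strvOfBiKummerData h R) hinvp)).base ≅ (ofBiKummerData h toB Q odd_l R ιX hopen (strvOfBiKummerData h R) K' constEmb constEmb_injective (hdivc_of_pull_invariant h.isDivisorial R (strvOfBiKummerData h R) (baseMap_strvOfBiKummerData h R) hinvc) (hdivp_of_pull_invariant h.isDivisorial R ιX (strvOfBiKummerData h R) (baseMap_strvOfBiKummerData h R) hinvp)).base ⋙ Ψbs)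
    (aΨ : ∀ A : S.C, (ofBiKummerData h toB Q odd_l R ιX hopen (strvOfBiKummerData h R) K' constEmb constEmb_injective (hdivc_of_pull_invariant h.isDivisorial R (strvOfBiKummerData h R) (baseMap_strvOfBiKummerData h R) hinvc) (hdivp_of_pull_invariant h.isDivisorial R ιX (strvOfBiKummerData h R) (baseMap_strvOfBiKummerData h R) hinvp)).lDeltaModN A ≃* (ofBiKummerData h toB Q odd_l R ιX hopen (strvOfBiKummerData h R) K' constEmb constEmb_injective (hdivc_of_pull_invariant h.isDivisorial R (strvOfBiKummerData h R) (baseMap_strvOfBiKummerData h R) hinvc) (hdivp_of_pull_invariant h.isDivisorial R ιX (strvOfBiKummerData h R) (baseMap_strvOfBiKummerData h R) hinvp)).lDeltaModN (Ψ.functor.obj A))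
    (hlin : PreFrobenioidData.PreservesMor Ψ.functor (ofBiKummerData h toB Q odd_l R ιX hopen (strvOfBiKummerData h R) K' constEmb constEmb_injective (hdivc_of_pull_invariant h.isDivisorial R (strvOfBiKummerData h R) (baseMap_strvOfBiKummerData h R) hinvc) (hdivp_of_pull_invariant h.isDivisorial R ιX (strvOfBiKummerData h R) (baseMap_strvOfBiKummerData h R) hinvp)).IsLinear (ofBiKummerData h toB Q odd_l R ιX hopen (strvOfBiKummerData h R) K' constEmb constEmb_injective (hdivc_of_pull_invariant h.isDivisorial R (strvOfBiKummerData h R) (baseMap_strvOfBiKummerData h R) hinvc) (hdivp_of_pull_invariant h.isDivisorial R ιX (strvOfBiKummerData h R) (baseMap_strvOfBiKummerData h R) hinvp)).IsLinear)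
    (haΨn : ∀ {A A' : S.C} (φ : A ⟶ A') (x : (ofBiKummerData h toB Q odd_l R ιX hopen (strvOfBiKummerData h R) K' constEmb constEmb_injective (hdivc_of_pull_invariant h.isDivisorial R (strvOfBiKummerData h R) (baseMap_strvOfBiKummerData h R) hinvc) (hdivp_of_pull_invariant h.isDivisorial R ιX (strvOfBiKummerData h R) (baseMap_strvOfBiKummerData h R) hinvp)).lDeltaModN A),
      aΨ A' ((ofBiKummerData h toB Q odd_l R ιX hopen (strvOfBiKummerData h R) K' constEmb constEmb_injective (hdivc_of_pull_invariant h.isDivisorial R (strvOfBiKummerData h R) (baseMap_strvOfBiKummerData h R) hinvc) (hdivp_of_pull_invariant h.isDivisorial R ιX (strvOfBiKummerData h R) (baseMap_strvOfBiKummerData h R) hinvp)).lDeltaModNMap φ x) = (ofBiKummerData h toB Q odd_l R ιX hopen (strvOfBiKummerData h R) K' constEmb constEmb_injective (hdivc_of_pull_invariant h.isDivisorial R (strvOfBiKummerData h R) (baseMap_strvOfBiKummerData h R) hinvc) (hdivp_of_pull_invariant h.isDivisorial R ιX (strvOfBiKummerData h R) (baseMap_strvOfBiKummerData h R) hinvp)).lDeltaModNMap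 (Ψ.functor.map φ) (aΨ A x))
    (hpull : ∀ {A A' : S.C} (φ : A ⟶ A') (u : (ofBiKummerData h toB Q odd_l R ιX hopen (strvOfBiKummerData h R) K' constEmb constEmb_injective (hdivc_of_pull_invariant h.isDivisorial R (strvOfBiKummerData h R) (baseMap_strvOfBiKummerData h R) hinvc) (hdivp_of_pull_invariant h.isDivisorial R ιX (strvOfBiKummerData h R) (baseMap_strvOfBiKummerData h R) hinvp)).muTorsion A' (ofBiKummerData h toB Q odd_l R ιX hopen (strvOfBiKummerData h R) K' constEmb constEmb_injective (hdivc_of_pull_invariant h.isDivisorial R (strvOfBiKummerData h R) (baseMap_strvOfBiKummerData h R) hinvc) (hdivp_of_pull_invariant h.isDivisorial R ιX (strvOfBiKummerData h R) (baseMap_strvOfBiKummerData h R) hinvp)).N)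
      (hu : Ψ.functor.mapAut A' (u : Aut A') ∈ (ofBiKummerData h toB Q odd_l R ιX hopen (strvOfBiKummerData h R) K' constEmb constEmb_injective (hdivc_of_pull_invariant h.isDivisorial R (strvOfBiKummerData h R) (baseMap_strvOfBiKummerData h R) hinvc) (hdivp_of_pull_invariant h.isDivisorial R ιX (strvOfBiKummerData h R) (baseMap_strvOfBiKummerData h R) hinvp)).muTorsion (Ψ.functor.obj A') (ofBiKummerData h toB Q odd_l R ιX hopen (strvOfBiKummerData h R) K' constEmb constEmb_injective (hdivc_of_pull_invariant h.isDivisorial R (strvOfBiKummerData h R) (baseMap_strvOfBiKummerData h R) hinvc) (hdivp_of_pull_invariant h.isDivisorial R ιX (strvOfBiKummerData h R) (baseMap_strvOfBiKummerData h R) hinvp)).N),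
      Ψ.functor.mapAut A ((ofBiKummerData h toB Q odd_l R ιX hopen (strvOfBiKummerData h R) K' constEmb constEmb_injective (hdivc_of_pull_invariant h.isDivisorial R (strvOfBiKummerData h R) (baseMap_strvOfBiKummerData h R) hinvc) (hdivp_of_pull_invariant h.isDivisorial R ιX (strvOfBiKummerData h R) (baseMap_strvOfBiKummerData h R) hinvp)).muTorsionPull φ (ofBiKummerData h toB Q odd_l R ιX hopen (strvOfBiKummerData h R) K' constEmb constEmb_injective (hdivc_of_pull_invariant h.isDivisorial R (strvOfBiKummerData h R) (baseMap_strvOfBiKummerData h R) hinvc) (hdivp_of_pull_invariant h.isDivisorial R ιX (strvOfBiKummerData h R) (baseMap_strvOfBiKummerData h R) hinvp)).N u : Aut A) = ((ofBiKummerData h toB Q odd_l R ιX hopen (strvOfBiKummerData h R) K' constEmb constEmb_injective (hdivc_of_pull_invariant h.isDivisorial R (strvOfBiKummerData h R) (baseMap_strvOfBiKummerData h R) hinvc) (hdivp_of_pull_invariant h.isDivisorial R ιX (strvOfBiKummerData h R) (baseMap_strvOfBiKummerData h R) hinvp)).muTorsionPull (Ψ.functor.map φ) (ofBiKummerData h toB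 Q odd_l R ιX hopen (strvOfBiKummerData h R) K' constEmb constEmb_injective (hdivc_of_pull_invariant h.isDivisorial R (strvOfBiKummerData h R) (baseMap_strvOfBiKummerData h R) hinvc) (hdivp_of_pull_invariant h.isDivisorial R ιX (strvOfBiKummerData h R) (baseMap_strvOfBiKummerData h R) hinvp)).N ⟨_, hu⟩ : Aut (Ψ.functor.obj A)))
    -- the NORMALISED Thm 5.7 transport (D_c = 1, e = 1: abc-iut-L2-d4 T1 + abc-iut-w5-d245 `capCupTransport_normalise`)
    (α : Ψ.functor.obj (ofBiKummerData h toB Q odd_l R ιX hopen (strvOfBiKummerData h R) K' constEmb constEmb_injective (hdivc_of_pull_invariant h.isDivisorial R (strvOfBiKummerData h R) (baseMap_strvOfBiKummerData h R) hinvc) (hdivp_of_pull_invariant h.isDivisorial R ιX (strvOfBiKummerData h R) (baseMap_strvOfBiKummerData h R) hinvp)).AN ≅ (ofBiKummerData h toB Q odd_l R ιX hopen (strvOfBiKummerData h R) K' constEmb constEmb_injective (hdivc_of_pull_invariant h.isDivisorial R (strvOfBiKummerData h R) (baseMap_strvOfBiKummerData h R) hinvc) (hdivp_of_pull_invariant h.isDivisorial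 R ιX (strvOfBiKummerData h R) (baseMap_strvOfBiKummerData h R) hinvp)).AN) (β : Ψ.functor.obj (ofBiKummerData h toB Q odd_l R ιX hopen (strvOfBiKummerData h R) K' constEmb constEmb_injective (hdivc_of_pull_invariant h.isDivisorial R (strvOfBiKummerData h R) (baseMap_strvOfBiKummerData h R) hinvc) (hdivp_of_pull_invariant h.isDivisorial R ιX (strvOfBiKummerData h R) (baseMap_strvOfBiKummerData h R) hinvp)).BN ≅ (ofBiKummerData h toB Q odd_l R ιX hopen (strvOfBiKummerData h R) K' constEmb constEmb_injective (hdivc_of_pull_invariant h.isDivisorial R (strvOfBiKummerData h R) (baseMap_strvOfBiKummerData h R) hinvc) (hdivp_of_pull_invariant h.isDivisorial R ιX (strvOfBiKummerData h R) (baseMap_strvOfBiKummerData h R) hinvp)).BN) {Dp₀ : Aut (ofBiKummerData h toB Q odd_l R ιX hopen (strvOfBiKummerData h R) K' constEmb constEmb_injective (hdivc_of_pull_invariant h.isDivisorial R (strvOfBiKummerData h R) (baseMap_strvOfBiKummerData h R) hinvc) (hdivp_of_pull_invariant h.isDivisorial R ιX (strvOfBiKummerData h R) (baseMap_strvOfBiKummerData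 h R) hinvp)).BN}
    (hc₁ : α.inv ≫ Ψ.functor.map (ofBiKummerData h toB Q odd_l R ιX hopen (strvOfBiKummerData h R) K' constEmb constEmb_injective (hdivc_of_pull_invariant h.isDivisorial R (strvOfBiKummerData h R) (baseMap_strvOfBiKummerData h R) hinvc) (hdivp_of_pull_invariant h.isDivisorial R ιX (strvOfBiKummerData h R) (baseMap_strvOfBiKummerData h R) hinvp)).sCap ≫ β.hom = (ofBiKummerData h toB Q odd_l R ιX hopen (strvOfBiKummerData h R) K' constEmb constEmb_injective (hdivc_of_pull_invariant h.isDivisorial R (strvOfBiKummerData h R) (baseMap_strvOfBiKummerData h R) hinvc) (hdivp_of_pull_invariant h.isDivisorial R ιX (strvOfBiKummerData h R) (baseMap_strvOfBiKummerData h R) hinvp)).sCap)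
    (hp₁ : α.inv ≫ Ψ.functor.map (ofBiKummerData h toB Q odd_l R ιX hopen (strvOfBiKummerData h R) K' constEmb constEmb_injective (hdivc_of_pull_invariant h.isDivisorial R (strvOfBiKummerData h R) (baseMap_strvOfBiKummerData h R) hinvc) (hdivp_of_pull_invariant h.isDivisorial R ιX (strvOfBiKummerData h R) (baseMap_strvOfBiKummerData h R) hinvp)).sCup ≫ β.hom = (ofBiKummerData h toB Q odd_l R ιX hopen (strvOfBiKummerData h R) K' constEmb constEmb_injective (hdivc_of_pull_invariant h.isDivisorial R (strvOfBiKummerData h R) (baseMap_strvOfBiKummerData h R) hinvc) (hdivp_of_pull_invariant h.isDivisorial R ιX (strvOfBiKummerData h R) (baseMap_strvOfBiKummerData h R) hinvp)).sCup ≫ Dp₀.hom) (hDp₀ : Dp₀ ∈ (ofBiKummerData h toB Q odd_l R ιX hopen (strvOfBiKummerData h R) K' constEmb constEmb_injective (hdivc_of_pull_invariant h.isDivisorial R (strvOfBiKummerData h R) (baseMap_strvOfBiKummerData h R) hinvc) (hdivp_of_pull_invariant h.isDivisorial R ιX (strvOfBiKummerData h R) (baseMap_strvOfBiKummerData h R)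 hinvp)).units (ofBiKummerData h toB Q odd_l R ιX hopen (strvOfBiKummerData h R) K' constEmb constEmb_injective (hdivc_of_pull_invariant h.isDivisorial R (strvOfBiKummerData h R) (baseMap_strvOfBiKummerData h R) hinvc) (hdivp_of_pull_invariant h.isDivisorial R ιX (strvOfBiKummerData h R) (baseMap_strvOfBiKummerData h R) hinvp)).BN)
    -- ([FrdI] Prop 5.6 pair at A_N: PRODUCED below for the constructed section — no binder)
    -- the MODEL HYPOTHESES of [FrdI] Thm 3.4 (iii)/(v) at the §4 tempered Frobenioid ([EtTh] Thm 3.7 (i)(ii))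
    (hD : IsOfFSMType D) (hslim : IsSlim D) (hnd : IsNonDilatingOn S.tf.divisorMonoid)
    (hN : ∃ A : S.C, ¬ (PreFrobenioidData.ofModel S.tf.divisorMonoid S.tf.ratFnFunctor S.tf.divBNatTrans).IsGroupLikeObj A)
    -- [EtTh] Cor 2.18 (i): the theta-related subquotients Π^tp_Ÿ, (l·Δ_Θ), … of Π^tp_X are CHARACTERISTIC (abc-iut-L2-t2's
    -- `RigidData.Cor218_i`, F-0620; discharged at the model data by abc-iut-L2-t8/L6) — supplies hP24/hγL for EVERY γ
    (h218i : RD.Cor218_i)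
    -- T56-L02 / T56-L09c for the Galois shadow of the PRODUCED base shadow of Ψ through α: ∃ γ with hγ and the Δ-transport law haΨ
    (hΓ' : ∀ θA : Aut R.AN.base ≃* Aut R.AN.base,
      (∀ f : Aut R.AN, (PreFrobenioid.baseFunctor S.F).mapIso (α.symm ≪≫ Ψ.functor.mapIso f ≪≫ α) =
        θA ((PreFrobenioid.baseFunctor S.F).mapIso f)) →
      ∃ γ : RD.PiX ≃ₜ* RD.PiX,
        (∀ y : RD.PiX, (((ofBiKummerData h toB Q odd_l R ιX hopen (strvOfBiKummerData h R) K' constEmb constEmb_injective (hdivc_of_pull_invariant h.isDivisorial R (strvOfBiKummerData h R) (baseMap_strvOfBiKummerData h R) hinvc) (hdivp_of_pull_invariant h.isDivisorial R ιX (strvOfBiKummerData h R) (baseMap_strvOfBiKummerData h R) hinvp)).autBaseIsoAB.symm.trans θA).trans (ofBiKummerData h toB Q odd_l R ιX hopen (strvOfBiKummerData h R) K' constEmb constEmb_injective (hdivc_of_pull_invariant h.isDivisorial R (strvOfBiKummerData h R) (baseMap_strvOfBiKummerData h R) hinvc) (hdivp_of_pull_invariant h.isDivisorial R ιX (strvOfBiKummerData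 h R) (baseMap_strvOfBiKummerData h R) hinvp)).autBaseIsoAB) (rhoOfBiKummerData R ιX y) =
          rhoOfBiKummerData R ιX (γ y)) ∧
        ∀ (k : RD.PiYdd) (hk : (k : RD.PiX) ∈ RD.lDeltaTheta) (hk' : γ k ∈ RD.lDeltaTheta),
          (ofBiKummerData h toB Q odd_l R ιX hopen (strvOfBiKummerData h R) K' constEmb constEmb_injective (hdivc_of_pull_invariant h.isDivisorial R (strvOfBiKummerData h R) (baseMap_strvOfBiKummerData h R) hinvc) (hdivp_of_pull_invariant h.isDivisorial R ιX (strvOfBiKummerData h R) (baseMap_strvOfBiKummerData h R) hinvp)).lDeltaModNMap β.hom (aΨ _ (e (RD.thetaMod ⟨k, hk⟩))) = e (RD.thetaMod ⟨γ k, hk'⟩)) :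
    ∃ ρ : RigidityFamily (ofBiKummerData h toB Q odd_l R ιX hopen (strvOfBiKummerData h R) K' constEmb constEmb_injective (hdivc_of_pull_invariant h.isDivisorial R (strvOfBiKummerData h R) (baseMap_strvOfBiKummerData h R) hinvc) (hdivp_of_pull_invariant h.isDivisorial R ιX (strvOfBiKummerData h R) (baseMap_strvOfBiKummerData h R) hinvp)), ThetaSubquotientProjGalois.IsKummerDetermined (𝔉 := ofBiKummerData h toB Q odd_l R ιX hopen (strvOfBiKummerData h R) K' constEmb constEmb_injective (hdivc_of_pull_invariant h.isDivisorial R (strvOfBiKummerData h R) (baseMap_strvOfBiKummerData h R) hinvc) (hdivp_of_pull_invariant h.isDivisorial R ιX (strvOfBiKummerData h R) (baseMap_strvOfBiKummerData h R) hinvp)) P ρ hB ∧ IsFunctorialLinear (ofBiKummerData h toB Q odd_l R ιX hopen (strvOfBiKummerData h R) K' constEmb constEmb_injective (hdivc_of_pull_invariant h.isDivisorial R (strvOfBiKummerData h R) (baseMap_strvOfBiKummerData h R) hinvc) (hdivp_of_pull_invariant h.isDivisorial R ιX (strvOfBiKummerData h R) (baseMap_strvOfBiKummerData h R) hinvp))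 ρ ∧
      (∀ ρ' : RigidityFamily (ofBiKummerData h toB Q odd_l R ιX hopen (strvOfBiKummerData h R) K' constEmb constEmb_injective (hdivc_of_pull_invariant h.isDivisorial R (strvOfBiKummerData h R) (baseMap_strvOfBiKummerData h R) hinvc) (hdivp_of_pull_invariant h.isDivisorial R ιX (strvOfBiKummerData h R) (baseMap_strvOfBiKummerData h R) hinvp)), ThetaSubquotientProjGalois.IsKummerDetermined (𝔉 := ofBiKummerData h toB Q odd_l R ιX hopen (strvOfBiKummerData h R) K' constEmb constEmb_injective (hdivc_of_pull_invariant h.isDivisorial R (strvOfBiKummerData h R) (baseMap_strvOfBiKummerData h R) hinvc) (hdivp_of_pull_invariant h.isDivisorial R ιX (strvOfBiKummerData h R) (baseMap_strvOfBiKummerData h R) hinvp)) P ρ' hB → IsFunctorialLinear (ofBiKummerData h toB Q odd_l R ιX hopen (strvOfBiKummerData h R) K' constEmb constEmb_injective (hdivc_of_pull_invariant h.isDivisorial R (strvOfBiKummerData h R) (baseMap_strvOfBiKummerData h R) hinvc) (hdivp_of_pull_invariant h.isDivisorial R ιX (strvOfBiKummerData h R) (baseMap_strvOfBiKummerData h R)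 hinvp)) ρ' → ρ' = ρ) ∧
      CyclotomicRigidityPreserved (ofBiKummerData h toB Q odd_l R ιX hopen (strvOfBiKummerData h R) K' constEmb constEmb_injective (hdivc_of_pull_invariant h.isDivisorial R (strvOfBiKummerData h R) (baseMap_strvOfBiKummerData h R) hinvc) (hdivp_of_pull_invariant h.isDivisorial R ιX (strvOfBiKummerData h R) (baseMap_strvOfBiKummerData h R) hinvp)) Ψ ρ aΨ := by
  refine exists_rigidityFamily_unique_preserved_ofBiKummerData_of_pin_strv_sectionPair_galois h toB Q odd_l R ιX hopen K' constEmb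
    constEmb_injective hinvc hinvp hB P hη₀ hdies e he hpre hP hcov' ν hKν hgeom hP34 hΔcnst hreach hLc hLi hGalT hproj H m hme hχX
    hcovHB hH hfrac haut Ψ Ψbs eΨ aΨ hlin haΨn hpull α β hc₁ hp₁ hDp₀ hD hslim hnd hN fun θA hθ => ?_
  obtain ⟨γ, hγ, haΨ⟩ := hΓ' θA hθ
  exact ⟨γ, hγ, (h218i γ).2.1, (h218i γ).2.2.2.2.1, haΨ⟩

end Abstract

/-! ### Capstone at the genuine data over `B^temp(Π^tp_X)⁰`, v2 record -/

section Connected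

variable {K : Type u₀} [Field K] {X : SemiGraphs.TemperedArithmeticGroup.{u₀} K} {D₀ : Type u₀} [Category.{v₀} D₀]
  {V : FrdIMonoidStub.{w}} {T₀ : RealifiedDivisorMonoids (D₀ := D₀) V}
  {VD : FrdICatStub.{u₀ + 1, u₀, w} (ConnectedPart (BTemp X.Pi))}
  {tf : TemperedFrobenioid T₀ (ConnectedPart (BTemp X.Pi)) VD} {hZ : tf.monoidType = MonoidType.Z}
  {hP : ∀ A : (ConnectedPart (BTemp X.Pi))ᵒᵖ, IsPerfect (tf.Φ.carrier A)}
  {NH : Subgroup (Field.absoluteGaloisGroup K) → tf.category → ℕ+ → Prop} {A₀ : tf.category}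
  {hA₀ : PreFrobenioid.IsFrobeniusTrivial tf.toElem A₀} {hA₀' : SemiGraphs.IsGaloisObj A₀.base.obj}
  {lv N : ℕ+} {l' : ℕ} {RD : RigidData.{max u₀ w} N l'}
  {pullFrac : ∀ {A A' : (BiKummerSetting.mkOfConnectedTemperoid X tf hZ hP NH A₀ hA₀ hA₀').C} (_ : A' ⟶ A),
    (BiKummerSetting.mkOfConnectedTemperoid X tf hZ hP NH A₀ hA₀ hA₀').biratUnits A →
      (BiKummerSetting.mkOfConnectedTemperoid X tf hZ hP NH A₀ hA₀ hA₀').biratUnits A'}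
  {θ : (BiKummerSetting.mkOfConnectedTemperoid X tf hZ hP NH A₀ hA₀ hA₀').biratUnits
    (BiKummerSetting.mkOfConnectedTemperoid X tf hZ hP NH A₀ hA₀ hA₀').Aodot}
  {Bl : (BiKummerSetting.mkOfConnectedTemperoid X tf hZ hP NH A₀ hA₀ hA₀').C}
  {Pl : (BiKummerSetting.mkOfConnectedTemperoid X tf hZ hP NH A₀ hA₀ hA₀').FractionPair θ Bl}
  {Rl : (BiKummerSetting.mkOfConnectedTemperoid X tf hZ hP NH A₀ hA₀ hA₀').NthRoot θ Pl lv pullFrac}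
  (h : ModelFrobenioid.Hypotheses tf.divisorMonoid tf.ratFnFunctor)
  (Q : FrobenioidTheta.ThetaSubquotientStub.{w} (ConnectedPart (BTemp X.Pi))) (odd_l : Odd (lv : ℕ))
  (R : (BiKummerSetting.mkOfConnectedTemperoid X tf hZ hP NH A₀ hA₀ hA₀').NthRoot Rl.root Rl.pair N pullFrac)
  (ιX : RD.PiX ≃ₜ* X.Pi) (K' : Type w) [Field K'] (constEmb : K'ˣ →* tf.biratUnitsModel R.BN)
  (constEmb_injective : Function.Injective constEmb)
  (hinvc : ∀ g : Aut R.AN.base,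
    pull tf.divisorMonoid g.hom (ModelFrobenioid.div R.pair.num) = ModelFrobenioid.div R.pair.num)
  (hinvp : ∀ y : RD.PiX, y ∈ RD.PiYdd →
    pull tf.divisorMonoid ((BiKummerSetting.mkOfConnectedTemperoid X tf hZ hP NH A₀ hA₀ hA₀').galoisSurj R.AN.base
      R.αData.isGalois (ιX y)).hom (ModelFrobenioid.div R.pair.den) = ModelFrobenioid.div R.pair.den)
  {Gal : ConnectedPart (BTemp X.Pi) → Prop}

/-- (v2 record `ThetaSubquotientProjGalois`; the v1 theorem `exists_rigidityFamily_unique_preserved_ofConnectedTemperoidData_capstone` VERBATIM — binder type + twin names only.) **K4 CAPSTONE at the genuine connected data over `B^temp(Π^tp_X)⁰`**: as `…_ofConnectedTemperoidData_allLeaves` with the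
base-Frobenius pair of `s^trv_N` DISCHARGED and `hP24`/`hγL` from Cor. 2.18 (i).  [cite: MochizukiEtTh2009, Thm 5.6 p.328 (PDF p.102)] -/
theorem exists_rigidityFamily_unique_preserved_ofConnectedTemperoidData_capstone_galois
    -- Prop 5.5 side (η / ν pin, reachability, stub laws)
    (hB : (ofConnectedTemperoidData h Q odd_l R ιX K' constEmb constEmb_injective hinvc hinvp).IsThetaSaturated (ofConnectedTemperoidData h Q odd_l R ιX K' constEmb constEmb_injective hinvc hinvp).BN) (P : ThetaSubquotientProjGalois (ofConnectedTemperoidData h Q odd_l R ιX K' constEmb constEmb_injective hinvc hinvp) Gal)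
    {η₀ : RD.PiYdd → RD.mu} (hη₀ : η₀ ∈ RD.thetaCocycles)
    (hdies : ∀ k : RD.PiYdd, rhoOfBiKummerData R ιX k = 1 → η₀ k = 1)
    (e : RD.mu → (ofConnectedTemperoidData h Q odd_l R ιX K' constEmb constEmb_injective hinvc hinvp).lDeltaModN (ofConnectedTemperoidData h Q odd_l R ιX K' constEmb constEmb_injective hinvc hinvp).BN) (he : Function.Surjective e)
    (hpre : ∀ k : RD.PiYdd, (k : RD.PiX) ∈ RD.lDeltaTheta → rhoOfBiKummerData R ιX k ∈ P.pre _)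
    (hPproj : ∀ (k : RD.PiYdd) (hk : (k : RD.PiX) ∈ RD.lDeltaTheta) (hm : rhoOfBiKummerData R ιX k ∈ P.pre _),
      (QuotientGroup.mk (P.proj _ ⟨rhoOfBiKummerData R ιX k, hm⟩) : (ofConnectedTemperoidData h Q odd_l R ιX K' constEmb constEmb_injective hinvc hinvp).lDeltaModN (ofConnectedTemperoidData h Q odd_l R ιX K' constEmb constEmb_injective hinvc hinvp).BN) = e (RD.thetaMod ⟨k, hk⟩))
    (hcov' : ∀ g ∈ P.pre ((ofConnectedTemperoidData h Q odd_l R ιX K' constEmb constEmb_injective hinvc hinvp).base.obj (ofConnectedTemperoidData h Q odd_l R ιX K' constEmb constEmb_injective hinvc hinvp).BN), ∃ k : RD.PiYdd, (k : RD.PiX) ∈ RD.lDeltaTheta ∧ rhoOfBiKummerData R ιX k = g)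
    (ν : (ofConnectedTemperoidData h Q odd_l R ιX K' constEmb constEmb_injective hinvc hinvp).lDeltaModN (ofConnectedTemperoidData h Q odd_l R ιX K' constEmb constEmb_injective hinvc hinvp).BN ≃* (ofConnectedTemperoidData h Q odd_l R ιX K' constEmb constEmb_injective hinvc hinvp).muTorsion (ofConnectedTemperoidData h Q odd_l R ιX K' constEmb constEmb_injective hinvc hinvp).BN (ofConnectedTemperoidData h Q odd_l R ιX K' constEmb constEmb_injective hinvc hinvp).N)
    (hKν : ∀ η : (ofConnectedTemperoidData h Q odd_l R ιX K' constEmb constEmb_injective hinvc hinvp).HB → (ofConnectedTemperoidData h Q odd_l R ιX K' constEmb constEmb_injective hinvc hinvp).lDeltaModN (ofConnectedTemperoidData h Q odd_l R ιX K' constEmb constEmb_injective hinvc hinvp).BN,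
      (∀ k : RD.PiYdd, η ⟨rhoOfBiKummerData R ιX k, Subgroup.mem_map_of_mem _ k.2⟩ = e (η₀ k)) →
        FrobenioidThetaBiKummer.ThetaPairKummerClass (ofConnectedTemperoidData h Q odd_l R ιX K' constEmb constEmb_injective hinvc hinvp) η ν)
    (hgeom : P.pre R.BN.base ≤ RD.aug.ker.map (rhoOfBiKummerData R ιX))
    -- T56-L09b: Prop 3.4 (ii) constants + the origin clause «cnst kills Ker aug» (G-w5d020-2)
    {Dcnst : Type u₁} [Category.{v₁} Dcnst] {cnst : D₀ ⥤ Dcnst} (hP34 : RealifiedDivisorMonoids.Prop34Cnst T₀ cnst)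
    (hΔcnst : ∀ δ ∈ RD.aug.ker,
      cnst.map (tf.base.map (rhoOfBiKummerData R ιX δ).hom) = 𝟙 (cnst.obj (tf.base.obj R.BN.base)))
    (hreach : LinearlyReachableFromBN (ofConnectedTemperoidData h Q odd_l R ιX K' constEmb constEmb_injective hinvc hinvp))
    (hLc : Thm56Sub.LDeltaMapComp (ofConnectedTemperoidData h Q odd_l R ιX K' constEmb constEmb_injective hinvc hinvp)) (hLi : Thm56Sub.LDeltaMapId (ofConnectedTemperoidData h Q odd_l R ιX K' constEmb constEmb_injective hinvc hinvp))
    -- P55-L06 leaves: hproj named (leaf (G) `hGalT` is a THEOREM here: Galois objects of B^temp(Π)⁰ are Aut-torsors)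
    (hproj : ∀ (g g' : Aut ((ofConnectedTemperoidData h Q odd_l R ιX K' constEmb constEmb_injective hinvc hinvp).base.obj (ofConnectedTemperoidData h Q odd_l R ιX K' constEmb constEmb_injective hinvc hinvp).BN)) (hh : g' ∈ P.pre _), ∃ hgh : g * g' * g⁻¹ ∈ P.pre _,
      (ofConnectedTemperoidData h Q odd_l R ιX K' constEmb constEmb_injective hinvc hinvp).lDeltaMap g.hom (P.proj _ ⟨g', hh⟩) = P.proj _ ⟨g * g' * g⁻¹, hgh⟩)
    -- hKR (G-L6t23-3) by abc-iut-w4-d099's PIN route (p-file Sec5ThetaSectionCompatOfKummerClass): «Prop 5.2 (iii) enters ONCE» —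
    -- the (η₀, ν) pin above + Facts + the cyclotome dictionary m with m ∘ ν ∘ e = id + cyclotomic-character compatibility (F-1306)
    (H : (ofConnectedTemperoidData h Q odd_l R ιX K' constEmb constEmb_injective hinvc hinvp).Facts)
    (m : (ofConnectedTemperoidData h Q odd_l R ιX K' constEmb constEmb_injective hinvc hinvp).muTorsion (ofConnectedTemperoidData h Q odd_l R ιX K' constEmb constEmb_injective hinvc hinvp).BN (ofConnectedTemperoidData h Q odd_l R ιX K' constEmb constEmb_injective hinvc hinvp).N ≃* RD.mu)
    (hme : ∀ x : RD.mu, m (ν (e x)) = x)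
    (hχX : (ofConnectedTemperoidData h Q odd_l R ιX K' constEmb constEmb_injective hinvc hinvp).CyclotomicCharacterCompatX RD.toThetaEnvData (MulEquiv.refl _) m)
    (hcovHB : ∀ k : (ofConnectedTemperoidData h Q odd_l R ιX K' constEmb constEmb_injective hinvc hinvp).HB, (k : Aut ((ofConnectedTemperoidData h Q odd_l R ιX K' constEmb constEmb_injective hinvc hinvp).base.obj (ofConnectedTemperoidData h Q odd_l R ιX K' constEmb constEmb_injective hinvc hinvp).BN)) ∈ P.pre _ →
      ∃ (y : RD.PiX) (_ : y ∈ RD.PiYdd), (ofConnectedTemperoidData h Q odd_l R ιX K' constEmb constEmb_injective hinvc hinvp).ρ y = k ∧ y ∈ RD.lDeltaTheta)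
    -- hdiff reduced to Π^tp_Ÿ ⊆ H_⊙ (`hfrac`, `haut` are THEOREMS here: [FrdI] Thm 5.2 (ii) dictionary, abc-iut-L2-t9/t4)
    (hH : ∀ y : RD.PiX, y ∈ RD.PiYdd → ιX y ∈ (BiKummerSetting.mkOfConnectedTemperoid X tf hZ hP NH A₀ hA₀ hA₀').Hodot)
    -- Thm 5.6 side: Ψ, its base shadow, Δ-transport and μ-pull data (abc-iut-L2-d4)
    (Ψ : (BiKummerSetting.mkOfConnectedTemperoid X tf hZ hP NH A₀ hA₀ hA₀').C ≌ (BiKummerSetting.mkOfConnectedTemperoid X tf hZ hP NH A₀ hA₀ hA₀').C) (Ψbs : ConnectedPart (BTemp X.Pi) ⥤ ConnectedPart (BTemp X.Pi)) [Ψbs.Faithful] (eΨ : Ψ.functor ⋙ (ofConnectedTemperoidData h Q odd_l R ιX K' constEmb constEmb_injective hinvc hinvp).base ≅ (ofConnectedTemperoidData h Q odd_l R ιX K' constEmb constEmb_injective hinvc hinvp).base ⋙ Ψbs)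
    (aΨ : ∀ A : (BiKummerSetting.mkOfConnectedTemperoid X tf hZ hP NH A₀ hA₀ hA₀').C, (ofConnectedTemperoidData h Q odd_l R ιX K' constEmb constEmb_injective hinvc hinvp).lDeltaModN A ≃* (ofConnectedTemperoidData h Q odd_l R ιX K' constEmb constEmb_injective hinvc hinvp).lDeltaModN (Ψ.functor.obj A))
    (hlin : PreFrobenioidData.PreservesMor Ψ.functor (ofConnectedTemperoidData h Q odd_l R ιX K' constEmb constEmb_injective hinvc hinvp).IsLinear (ofConnectedTemperoidData h Q odd_l R ιX K' constEmb constEmb_injective hinvc hinvp).IsLinear)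
    (haΨn : ∀ {A A' : (BiKummerSetting.mkOfConnectedTemperoid X tf hZ hP NH A₀ hA₀ hA₀').C} (φ : A ⟶ A') (x : (ofConnectedTemperoidData h Q odd_l R ιX K' constEmb constEmb_injective hinvc hinvp).lDeltaModN A),
      aΨ A' ((ofConnectedTemperoidData h Q odd_l R ιX K' constEmb constEmb_injective hinvc hinvp).lDeltaModNMap φ x) = (ofConnectedTemperoidData h Q odd_l R ιX K' constEmb constEmb_injective hinvc hinvp).lDeltaModNMap (Ψ.functor.map φ) (aΨ A x))
    (hpull : ∀ {A A' : (BiKummerSetting.mkOfConnectedTemperoid X tf hZ hP NH A₀ hA₀ hA₀').C} (φ : A ⟶ A') (u : (ofConnectedTemperoidData h Q odd_l R ιX K' constEmb constEmb_injective hinvc hinvp).muTorsion A' (ofConnectedTemperoidData h Q odd_l R ιX K' constEmb constEmb_injective hinvc hinvp).N)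
      (hu : Ψ.functor.mapAut A' (u : Aut A') ∈ (ofConnectedTemperoidData h Q odd_l R ιX K' constEmb constEmb_injective hinvc hinvp).muTorsion (Ψ.functor.obj A') (ofConnectedTemperoidData h Q odd_l R ιX K' constEmb constEmb_injective hinvc hinvp).N),
      Ψ.functor.mapAut A ((ofConnectedTemperoidData h Q odd_l R ιX K' constEmb constEmb_injective hinvc hinvp).muTorsionPull φ (ofConnectedTemperoidData h Q odd_l R ιX K' constEmb constEmb_injective hinvc hinvp).N u : Aut A) = ((ofConnectedTemperoidData h Q odd_l R ιX K' constEmb constEmb_injective hinvc hinvp).muTorsionPull (Ψ.functor.map φ) (ofConnectedTemperoidData h Q odd_l R ιX K' constEmb constEmb_injective hinvc hinvp).N ⟨_, hu⟩ : Aut (Ψ.functor.obj A)))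
    -- the NORMALISED Thm 5.7 transport (D_c = 1, e = 1: abc-iut-L2-d4 T1 + abc-iut-w5-d245 `capCupTransport_normalise`)
    (α : Ψ.functor.obj (ofConnectedTemperoidData h Q odd_l R ιX K' constEmb constEmb_injective hinvc hinvp).AN ≅ (ofConnectedTemperoidData h Q odd_l R ιX K' constEmb constEmb_injective hinvc hinvp).AN) (β : Ψ.functor.obj (ofConnectedTemperoidData h Q odd_l R ιX K' constEmb constEmb_injective hinvc hinvp).BN ≅ (ofConnectedTemperoidData h Q odd_l R ιX K' constEmb constEmb_injective hinvc hinvp).BN) {Dp₀ : Aut (ofConnectedTemperoidData h Q odd_l R ιX K' constEmb constEmb_injective hinvc hinvp).BN}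
    (hc₁ : α.inv ≫ Ψ.functor.map (ofConnectedTemperoidData h Q odd_l R ιX K' constEmb constEmb_injective hinvc hinvp).sCap ≫ β.hom = (ofConnectedTemperoidData h Q odd_l R ιX K' constEmb constEmb_injective hinvc hinvp).sCap)
    (hp₁ : α.inv ≫ Ψ.functor.map (ofConnectedTemperoidData h Q odd_l R ιX K' constEmb constEmb_injective hinvc hinvp).sCup ≫ β.hom = (ofConnectedTemperoidData h Q odd_l R ιX K' constEmb constEmb_injective hinvc hinvp).sCup ≫ Dp₀.hom) (hDp₀ : Dp₀ ∈ (ofConnectedTemperoidData h Q odd_l R ιX K' constEmb constEmb_injective hinvc hinvp).units (ofConnectedTemperoidData h Q odd_l R ιX K' constEmb constEmb_injective hinvc hinvp).BN)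
    -- [FrdI] Prop 5.6 / Thm 3.4 (iii) data at A_N (abc-iut-w5-d245's Prop 5.6 unit)
    -- the MODEL HYPOTHESES of [FrdI] Thm 3.4 (iii)/(v) at the §4 tempered Frobenioid ([EtTh] Thm 3.7 (i)(ii))
    (hD : IsOfFSMType (ConnectedPart (BTemp X.Pi))) (hslim : IsSlim (ConnectedPart (BTemp X.Pi))) (hnd : IsNonDilatingOn tf.divisorMonoid)
    (hN : ∃ A : (BiKummerSetting.mkOfConnectedTemperoid X tf hZ hP NH A₀ hA₀ hA₀').C, ¬ (PreFrobenioidData.ofModel tf.divisorMonoid tf.ratFnFunctor tf.divBNatTrans).IsGroupLikeObj A)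
    -- [EtTh] Cor 2.18 (i): the theta-related subquotients Π^tp_Ÿ, (l·Δ_Θ), … of Π^tp_X are CHARACTERISTIC (abc-iut-L2-t2's
    -- `RigidData.Cor218_i`, F-0620; discharged at the model data by abc-iut-L2-t8/L6) — supplies hP24/hγL for EVERY γ
    (h218i : RD.Cor218_i)
    -- T56-L02 / T56-L09c for the Galois shadow of the PRODUCED base shadow of Ψ through α: ∃ γ with hγ and the Δ-transport law haΨ
    (hΓ' : ∀ θA : Aut R.AN.base ≃* Aut R.AN.base,
      (∀ f : Aut R.AN, (PreFrobenioid.baseFunctor (BiKummerSetting.mkOfConnectedTemperoid X tf hZ hP NH A₀ hA₀ hA₀').F).mapIso (α.symm ≪≫ Ψ.functor.mapIso f ≪≫ α) =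
        θA ((PreFrobenioid.baseFunctor (BiKummerSetting.mkOfConnectedTemperoid X tf hZ hP NH A₀ hA₀ hA₀').F).mapIso f)) →
      ∃ γ : RD.PiX ≃ₜ* RD.PiX,
        (∀ y : RD.PiX, (((ofConnectedTemperoidData h Q odd_l R ιX K' constEmb constEmb_injective hinvc hinvp).autBaseIsoAB.symm.trans θA).trans (ofConnectedTemperoidData h Q odd_l R ιX K' constEmb constEmb_injective hinvc hinvp).autBaseIsoAB) (rhoOfBiKummerData R ιX y) =
          rhoOfBiKummerData R ιX (γ y)) ∧
        ∀ (k : RD.PiYdd) (hk : (k : RD.PiX) ∈ RD.lDeltaTheta) (hk' : γ k ∈ RD.lDeltaTheta),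
          (ofConnectedTemperoidData h Q odd_l R ιX K' constEmb constEmb_injective hinvc hinvp).lDeltaModNMap β.hom (aΨ _ (e (RD.thetaMod ⟨k, hk⟩))) = e (RD.thetaMod ⟨γ k, hk'⟩)) :
    ∃ ρ : RigidityFamily (ofConnectedTemperoidData h Q odd_l R ιX K' constEmb constEmb_injective hinvc hinvp), ThetaSubquotientProjGalois.IsKummerDetermined (𝔉 := ofConnectedTemperoidData h Q odd_l R ιX K' constEmb constEmb_injective hinvc hinvp) P ρ hB ∧ IsFunctorialLinear (ofConnectedTemperoidData h Q odd_l R ιX K' constEmb constEmb_injective hinvc hinvp) ρ ∧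
      (∀ ρ' : RigidityFamily (ofConnectedTemperoidData h Q odd_l R ιX K' constEmb constEmb_injective hinvc hinvp), ThetaSubquotientProjGalois.IsKummerDetermined (𝔉 := ofConnectedTemperoidData h Q odd_l R ιX K' constEmb constEmb_injective hinvc hinvp) P ρ' hB → IsFunctorialLinear (ofConnectedTemperoidData h Q odd_l R ιX K' constEmb constEmb_injective hinvc hinvp) ρ' → ρ' = ρ) ∧
      CyclotomicRigidityPreserved (ofConnectedTemperoidData h Q odd_l R ιX K' constEmb constEmb_injective hinvc hinvp) Ψ ρ aΨ := by
  -- the section pair of the constructed `s^trv_N` at this data ([FrdI] Prop 5.6, `exists_sectionPair_strvOfBiKummerData`)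
  obtain ⟨φ, hφ, hc⟩ := exists_sectionPair_strvOfBiKummerData
    (S := BiKummerSetting.mkOfConnectedTemperoid X tf hZ hP NH A₀ hA₀ hA₀') h R
  refine exists_rigidityFamily_unique_preserved_ofConnectedTemperoidData_allLeaves_galois h Q odd_l R ιX K' constEmb constEmb_injective
    hinvc hinvp hB P hη₀ hdies e he hpre hPproj hcov' ν hKν hgeom hP34 hΔcnst hreach hLc hLi hproj H m hme hχX hcovHB hH Ψ Ψbs eΨ
    aΨ hlin haΨn hpull α β hc₁ hp₁ hDp₀ φ hφ hc hD hslim hnd hN fun θA hθ => ?_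
  obtain ⟨γ, hγ, haΨ⟩ := hΓ' θA hθ
  exact ⟨γ, hγ, (h218i γ).2.1, (h218i γ).2.2.2.2.1, haΨ⟩

end Connected

end ThetaFrobenioid

end Literature.AnabelianGeometry.EtaleTheta

end
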